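import Summits.Schanuel.Schanuel.Theorems.ZilberEacConicTranscendence
import Summits.Schanuel.Schanuel.Theorems.ZilberEacSuperellipticConstFibre
import HarnessLib

/-!
# Arbitrary base branches, XLIV: THE CONICS — constant fibres over `x₁² = x₀² + p₁x₀ + p₀` are in
# Mantova–Masser's case AND dense (THEOREM T; no growth anywhere)

HONEST FRAMING.  Cell `pub-schanuel` (Zilber's Exponential-Algebraic Closedness, case ladder;
host summit Schanuel), seat 2, gen 29.  File XLIII supplies the branch `η` of the conic at infinity
(`x₁ = x₀ + p₁/2 + η(1/x₀)`) and the transcendence of `u ↦ θ'e^{η(u)}` over `ℂ(1/u)`.  Here the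
exponential points `x₀ = τ + 2πin` (`e^τ = θ`) of the constant-fibre cylinder
`{x₁² − P(x₀) = 0, y₀ = θ}` are placed on that branch; they satisfy the EXACT relation
`y₁ = θe^{p₁/2}e^{η(1/x₀)}`, so THEOREM T (`unprojectedDense_of_transcendental_relation`, gen 22)
gives **`unprojectedDensityQuestion_conic_constFibre`**: for every monic quadratic `P` with simple
roots and every `θ ≠ 0`, case ∧ DENSE — the pair `(k, deg P) = (2, 2)` that the growth method of
files XIX–XLII cannot touch (both asymptotes have rational slope).  Decided instances of an OPEN
question (Mantova–Masser, PLMS 2024 §1 p. 5); EC(3,2) OPEN; NOT Schanuel's conjecture (neither used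
nor implied); EAC ⇏ SC.
-/

noncomputable section

open Filter Topology Set Complex Polynomial
open Literature.NumberTheory.Transcendental Literature.ModelTheory.Zilber
open Literature.ModelTheory.ExponentialFields

set_option linter.dupNamespace false

namespace Summit.Schanuel.Schanuel.Theorems

/-! ## Part B. Constant fibres over conics -/

section Conic

variable (P : Polynomial ℂ)

/-- **Constant fibres over a conic are dense.**  `P` monic of degree `2` with a simple root `r`,
`θ ≠ 0`: `{x₁² − P(x₀) = 0, y₀ = θ}` has Zariski-dense exponential points (THEOREM T along the
place `x₁ − x₀ → p₁/2`). [cite: MantovaMasser2023, §1 Further remarks, p. 5 (the question, open in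
general)] (new) -/
theorem unprojectedDense_conic_constFibre (hP : P.Monic) (h2 : P.natDegree = 2) {r : ℂ}
    (hr : P.IsRoot r) (hr1 : P.derivative.eval r ≠ 0) {θ : ℂ} (hθ : θ ≠ 0) :
    UnprojectedDense {w : Fin 2 ⊕ Fin 2 → ℂ |
      MvPolynomial.eval ![w (Sum.inl 0), w (Sum.inl 1)]
          (MvPolynomial.X 1 ^ 2 - Polynomial.aeval (MvPolynomial.X 0 : MvPolynomial (Fin 2) ℂ) P) = 0 ∧
      w (Sum.inr 0) = MvPolynomial.eval ![w (Sum.inl 0), w (Sum.inl 1)]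
        (MvPolynomial.C θ : MvPolynomial (Fin 2) ℂ)} := by
  classical
  set p₁ : ℂ := P.coeff 1 with hp₁
  set p₀ : ℂ := P.coeff 0 with hp₀
  have hPeval : ∀ x : ℂ, P.eval x = x ^ 2 + p₁ * x + p₀ := by
    intro x
    rw [Polynomial.eval_eq_sum_range' (show P.natDegree < 3 by omega)]
    simp only [Finset.sum_range_succ, Finset.sum_range_zero, zero_add, pow_zero, mul_one, pow_one]
    have h2c : P.coeff 2 = 1 := by rw [← h2]; exact hP.coeff_natDegree
    rw [h2c, ← hp₀, ← hp₁]
    ring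
  set c : ℂ := p₀ - p₁ ^ 2 / 4 with hc
  have hc0 : c ≠ 0 := by
    -- `P(r) = 0`, `P'(r) = 2r + p₁ ≠ 0` ⟹ `c = −(r + p₁/2)² ≠ 0`
    have hPr : r ^ 2 + p₁ * r + p₀ = 0 := by rw [← hPeval]; exact hr
    have hPr' : 2 * r + p₁ ≠ 0 := by
      have h : P.derivative.eval r = 2 * r + p₁ := by
        rw [Polynomial.derivative_eval, Polynomial.sum_over_range' _ _ 3 (by omega)]
        · simp only [Finset.sum_range_succ, Finset.sum_range_zero, zero_add]
          have h2c : P.coeff 2 = 1 := by rw [← h2]; exact hP.coeff_natDegree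
          rw [h2c, ← hp₁]
          norm_num
          ring
        · intro n; simp
      rw [← h]; exact hr1
    intro hc0
    have : (2 * r + p₁) ^ 2 = 0 := by
      have : c = 0 := hc0
      rw [hc] at this
      linear_combination 4 * hPr - 4 * this
    exact hPr' (pow_eq_zero_iff two_ne_zero |>.1 this)
  -- the surface data
  have hirr := irreducible_superellipticMv P (by norm_num : 1 ≤ 2) hr hr1
  have hS := isIrreducibleClosed_curveGraphFibre (MvPolynomial.C θ : MvPolynomial (Fin 2) ℂ) hirr
  have hdim := zariskiDim_curveGraphFibre (MvPolynomial.C θ : MvPolynomial (Fin 2) ℂ) hirr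
  -- the branch `η` and the label sequence
  obtain ⟨η, hηan, hη0, hηQ⟩ := exists_conic_branch p₁ c
  set τ : ℂ := Complex.log θ with hτ
  have heτ : Complex.exp τ = θ := Complex.exp_log hθ
  set X₀ : ℕ → ℂ := fun m => τ + ((m : ℂ) + 1) * (2 * Real.pi * I) with hX₀
  have hX₀norm : Tendsto (fun m => ‖X₀ m‖) atTop atTop := by
    have hlow : ∀ m : ℕ, 2 * Real.pi * ((m : ℝ) + 1) - ‖τ‖ ≤ ‖X₀ m‖ := by
      intro m
      have h1 : ‖((m : ℂ) + 1) * (2 * Real.pi * I)‖ = 2 * Real.pi * ((m : ℝ) + 1) := by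
        rw [norm_mul, show ((m : ℂ) + 1) = (((m : ℝ) + 1 : ℝ) : ℂ) by push_cast; ring,
          Complex.norm_real, Real.norm_eq_abs, abs_of_pos (by positivity)]
        simp [abs_of_pos Real.pi_pos]
        ring
      have h2 := norm_sub_norm_le (((m : ℂ) + 1) * (2 * Real.pi * I)) (-τ)
      rw [norm_neg, sub_neg_eq_add] at h2
      have e : ((m : ℂ) + 1) * (2 * Real.pi * I) + τ = X₀ m := by simp only [hX₀]; ring
      rw [e, h1] at h2
      exact h2
    refine tendsto_atTop_mono hlow ?_
    refine tendsto_atTop_add_const_right _ _ ?_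
    refine Tendsto.const_mul_atTop (by positivity) ?_
    exact tendsto_atTop_add_const_right _ 1 tendsto_natCast_atTop_atTop
  have hX₀inv : Tendsto (fun m => (X₀ m)⁻¹) atTop (𝓝 0) :=
    tendsto_inv₀_cobounded.comp (tendsto_norm_atTop_iff_cobounded.1 hX₀norm)
  -- from some index on: `X₀ m ≠ 0` and `1/X₀ m` in the domain of `η`'s identity
  obtain ⟨M₀, hM₀⟩ := Filter.eventually_atTop.1
    ((hX₀inv.eventually hηQ).and (hX₀norm.eventually (eventually_gt_atTop 0)))
  set x₀s : ℕ → ℂ := fun m => X₀ (M₀ + m) with hx₀s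
  have hx₀ne : ∀ m, x₀s m ≠ 0 := fun m => by
    have := (hM₀ (M₀ + m) (Nat.le_add_right _ _)).2
    exact norm_pos_iff.1 this
  have hηx : ∀ m, (x₀s m)⁻¹ * η ((x₀s m)⁻¹) ^ 2 + (2 + p₁ * (x₀s m)⁻¹) * η ((x₀s m)⁻¹) -
      c * (x₀s m)⁻¹ = 0 := fun m => (hM₀ (M₀ + m) (Nat.le_add_right _ _)).1
  -- the points
  set pt : ℕ → Fin 2 ⊕ Fin 2 → ℂ := fun m =>
    Sum.elim ![x₀s m, x₀s m + p₁ / 2 + η ((x₀s m)⁻¹)]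
      ![θ, Complex.exp (x₀s m + p₁ / 2 + η ((x₀s m)⁻¹))] with hpt
  have hexp₀ : ∀ m, Complex.exp (x₀s m) = θ := by
    intro m
    simp only [hx₀s, hX₀]
    rw [Complex.exp_add, heτ, show ((((M₀ + m : ℕ) : ℂ) + 1) * (2 * Real.pi * I)) =
      ((M₀ + m + 1 : ℕ) : ℂ) * (2 * Real.pi * I) by push_cast; ring, Complex.exp_nat_mul_two_pi_mul_I,
      mul_one]
  have hptS : ∀ m, pt m ∈ {w : Fin 2 ⊕ Fin 2 → ℂ |
      MvPolynomial.eval ![w (Sum.inl 0), w (Sum.inl 1)]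
          (MvPolynomial.X 1 ^ 2 - Polynomial.aeval (MvPolynomial.X 0 : MvPolynomial (Fin 2) ℂ) P) = 0 ∧
      w (Sum.inr 0) = MvPolynomial.eval ![w (Sum.inl 0), w (Sum.inl 1)]
        (MvPolynomial.C θ : MvPolynomial (Fin 2) ℂ)} := by
    intro m
    refine ⟨?_, by simp [hpt]⟩
    simp only [hpt, Sum.elim_inl, Matrix.cons_val_zero, Matrix.cons_val_one]
    rw [eval_superellipticMv]
    simp only [Matrix.cons_val_zero, Matrix.cons_val_one, hPeval]
    have hx := hx₀ne m
    have h := hηx m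
    have h' : η ((x₀s m)⁻¹) ^ 2 + (2 * x₀s m + p₁) * η ((x₀s m)⁻¹) - c =
        x₀s m * ((x₀s m)⁻¹ * η ((x₀s m)⁻¹) ^ 2 + (2 + p₁ * (x₀s m)⁻¹) * η ((x₀s m)⁻¹) -
          c * (x₀s m)⁻¹) := by
      field_simp
    rw [h, mul_zero, hc] at h'
    linear_combination h'
  have hpΓ : ∀ m, pt m ∈ expGraph ℂ 2 := by
    intro m
    rw [mem_expGraph_iff]
    intro i
    rw [Literature.ModelTheory.ExponentialFields.ExponentialRing.complex_exp_eq]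
    fin_cases i
    · simp [hpt, hexp₀ m]
    · simp [hpt]
  have hnorm : Tendsto (fun m => ‖pt m (Sum.inl 0)‖) atTop atTop := by
    have h : Tendsto (fun m => ‖x₀s m‖) atTop atTop :=
      hX₀norm.comp ((tendsto_add_atTop_nat M₀).congr fun m => by ring)
    refine h.congr fun m => ?_
    simp [hpt]
  set w : ℂ → ℂ := fun u => θ * Complex.exp (p₁ / 2) * Complex.exp (η u) with hw
  have hwan : AnalyticAt ℂ w 0 := analyticAt_const.mul hηan.cexp
  have hrel : ∀ m, pt m (Sum.inr 1) = w (pt m (Sum.inl 0))⁻¹ := by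
    intro m
    simp only [hpt, hw, Sum.elim_inr, Sum.elim_inl, Matrix.cons_val_one, Matrix.cons_val_zero]
    rw [Complex.exp_add, Complex.exp_add, hexp₀ m]
  have hθ' : θ * Complex.exp (p₁ / 2) ≠ 0 := mul_ne_zero hθ (Complex.exp_ne_zero _)
  exact unprojectedDense_of_transcendental_relation hS (le_of_eq hdim) 0 1 hptS hpΓ hnorm hwan hrel
    (fun H hH0 => conic_exp_relation_transcendental hc0 hθ' hηan hη0 hηQ H hH0)

/-- **Mantova–Masser's question for constant fibres over conics: case ∧ dense.**  `P` monic of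
degree `2` with a simple root, `θ ≠ 0`: `{x₁² − P(x₀) = 0, y₀ = θ}` is in the case AND dense, in
plain coordinates. [cite: MantovaMasser2023, §1 Further remarks, p. 5 (the question, open in
general)] (new) -/
theorem unprojectedDensityQuestion_conic_constFibre (hP : P.Monic) (h2 : P.natDegree = 2) {r : ℂ}
    (hr : P.IsRoot r) (hr1 : P.derivative.eval r ≠ 0) {θ : ℂ} (hθ : θ ≠ 0) :
    MMCaseDimPiOneFree {w : Fin 2 ⊕ Fin 2 → ℂ |
        w (Sum.inl 1) ^ 2 - P.eval (w (Sum.inl 0)) = 0 ∧ w (Sum.inr 0) = θ} ∧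
      UnprojectedDense {w : Fin 2 ⊕ Fin 2 → ℂ |
        w (Sum.inl 1) ^ 2 - P.eval (w (Sum.inl 0)) = 0 ∧ w (Sum.inr 0) = θ} := by
  have e : {w : Fin 2 ⊕ Fin 2 → ℂ |
        MvPolynomial.eval ![w (Sum.inl 0), w (Sum.inl 1)]
            (MvPolynomial.X 1 ^ 2 - Polynomial.aeval (MvPolynomial.X 0 : MvPolynomial (Fin 2) ℂ) P) = 0 ∧
        w (Sum.inr 0) = MvPolynomial.eval ![w (Sum.inl 0), w (Sum.inl 1)]
          (MvPolynomial.C θ : MvPolynomial (Fin 2) ℂ)} =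
      {w : Fin 2 ⊕ Fin 2 → ℂ |
        w (Sum.inl 1) ^ 2 - P.eval (w (Sum.inl 0)) = 0 ∧ w (Sum.inr 0) = θ} := by
    ext w
    simp only [Set.mem_setOf_eq, eval_superellipticMv, MvPolynomial.eval_C, Matrix.cons_val_zero,
      Matrix.cons_val_one]
  have h : MMCaseDimPiOneFree _ ∧ UnprojectedDense _ :=
    ⟨mmCase_superelliptic_constFibre P (k := 2) le_rfl hr hr1 hθ,
      unprojectedDense_conic_constFibre P hP h2 hr hr1 hθ⟩
  rw [e] at h
  exact h

end Conic

end Summit.Schanuel.Schanuel.Theorems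

end
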